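import Literature.NumberTheory.GaloisRepresentations.HasseArfResidueExt
import Literature.NumberTheory.GaloisRepresentations.HasseArfReductionProofs
import Literature.NumberTheory.GaloisRepresentations.HasseArfCyclicBasic
import Literature.NumberTheory.GaloisRepresentations.ArtinRepresentationHasseArfProofs
import HarnessLib

/-!
# The Hasse–Arf theorem (`hasseArf_holds`) and `card_inf_inertia_dvd_finsum_card_inf_ramificationSubgroup_holds`

We discharge the named facts `Literature.NumberTheory.GaloisRepresentations.hasseArf`
(Hasse–Arf: the upper jumps of a finite abelian extension of Dedekind domains at a maximal ideal
with separable residue extension are integers) and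
`Literature.NumberTheory.GaloisRepresentations.card_inf_inertia_dvd_finsum_card_inf_ramificationSubgroup`
(`|H ∩ G_0| ∣ Σ_{(H ∩ G_i) ⊄ ker θ} |H ∩ G_i|`, the integrality input of Artin's conductor theorem),
completion-free, along Serre, *Local Fields*, Ch. IV §3 and Ch. V §§3–7:

* the cyclic totally ramified core (Serre's Prop. V.11) is
  `card_dvd_ramificationCardSum_of_exists_sub_natCast_notMem` (`HasseArfCyclic`, via
  `HasseArfLayerTrace`, `HasseArfLayerNorm`, `HasseArfTower`), valid when the residue field is not
  the prime field;
* when the residue field *is* the prime field `𝔽_p` (then it is finite and every residue class is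
  the class of a natural number) we enlarge it by the unramified quadratic base change of
  `HasseArfQuadraticExt`/`HasseArfResidueExt` (`f = X² + X + 1` for `p = 2`, `f = X² - c` with `c̄`
  a non-square for `p` odd), Serre V §4 Lemma 7 / §7 p. 94;
* `exists_natCast_eq_herbrandPhi_of_isCyclic_of_inertia_eq_top` is then Prop. V.11 in the form
  `h11` consumed by the tree's reduction `hasseArf_of_cyclic` (`HasseArfReductionProofs`: Thm. 1
  from Prop. 11, Serre V §7), which gives `hasseArf_holds`; and
  `card_inf_inertia_dvd_finsum_card_inf_ramificationSubgroup_of_hasseArf`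
  (`ArtinRepresentationHasseArfProofs`) gives the second fact.

## References

* J.-P. Serre, *Local Fields*, GTM 67, Springer 1979: Ch. IV §3 (Hasse–Arf), Ch. V §7 (Thm 1,
  Thm 1', Prop. 11), Ch. V §4 Lemma 7, Ch. VI §2. [SerreLocalFields1979]
-/

open Polynomial
open scoped Pointwise

noncomputable section

namespace Literature.NumberTheory.GaloisRepresentations

universe u v w

/-! ### `G` versus its subgroup `⊤` -/

section TopSubgroup

/-- `|(⊤ : Subgroup G)_i| = |G_i|`. [folklore] -/
theorem card_ramificationSubgroup_top {S : Type*} [CommRing S] (𝔓 : Ideal S) (G : Type*) [Group G]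
    [MulSemiringAction G S] (i : ℕ) :
    Nat.card (𝔓.ramificationSubgroup (⊤ : Subgroup G) i) = Nat.card (𝔓.ramificationSubgroup G i) :=
  Nat.card_congr
    { toFun := fun σ => ⟨((σ : (⊤ : Subgroup G)) : G),
        (mem_ramificationSubgroup_subgroup_iff 𝔓 (⊤ : Subgroup G)).mp σ.2⟩
      invFun := fun g => ⟨⟨g, Subgroup.mem_top _⟩,
        (mem_ramificationSubgroup_subgroup_iff 𝔓 (⊤ : Subgroup G)).mpr g.2⟩
      left_inv := fun _ => rfl
      right_inv := fun _ => rfl }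

end TopSubgroup

/-! ### Prop. V.11 for a cyclic totally ramified `(L, 𝔓)` -/

section Prop11

variable {R : Type*} (K L : Type*) [CommRing R] [Field K] [Field L] [Algebra R K] [Algebra R L]
  [Algebra K L] [IsScalarTower R K L] [IsDedekindDomain R] [IsFractionRing R K]
  [FiniteDimensional K L] [IsGalois K L]

/-- **Prop. V.11, residue field not the prime field**: `|G| ∣ Σ_{i=1}^{μ} |G_i|` for `L/K` cyclic
totally ramified at `𝔓` with last jump `μ`, directly from
`card_dvd_ramificationCardSum_of_exists_sub_natCast_notMem` with `H = G`.
Ref: Serre, *Local Fields*, Ch. V §7, Prop. 11. [cite: SerreLocalFields1979, Ch. V §7 Prop. 11] -/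
theorem card_dvd_sum_card_of_exists_sub_natCast_notMem [IsCyclic (L ≃ₐ[K] L)]
    (𝔓 : Ideal (integralClosure R L)) [𝔓.IsMaximal] (h𝔓 : 𝔓 ≠ ⊥)
    [Algebra.IsSeparable (R ⧸ 𝔓.under R) (integralClosure R L ⧸ 𝔓)]
    (htot : 𝔓.inertia (L ≃ₐ[K] L) = ⊤)
    (hbig : ∃ b : integralClosure R L, ∀ m : ℕ, b - m ∉ 𝔓) {μ : ℕ}
    (hμ : 𝔓.ramificationSubgroup (L ≃ₐ[K] L) μ ≠ ⊥)
    (hμ1 : 𝔓.ramificationSubgroup (L ≃ₐ[K] L) (μ + 1) = ⊥) :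
    Nat.card (L ≃ₐ[K] L) ∣ ∑ i ∈ Finset.Icc 1 μ, Nat.card (𝔓.ramificationSubgroup (L ≃ₐ[K] L) i) := by
  classical
  haveI : IsMulCommutative (L ≃ₐ[K] L) := IsCyclic.isMulCommutative
  haveI : IsCyclic (⊤ : Subgroup (L ≃ₐ[K] L)) :=
    isCyclic_of_surjective (Subgroup.topEquiv (G := L ≃ₐ[K] L)).symm (MulEquiv.surjective _)
  have hH : (⊤ : Subgroup (L ≃ₐ[K] L)) ≤ 𝔓.inertia (L ≃ₐ[K] L) := by rw [htot]
  have hc := fun i => card_ramificationSubgroup_top 𝔓 (L ≃ₐ[K] L) i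
  have hμ' : 𝔓.ramificationSubgroup (⊤ : Subgroup (L ≃ₐ[K] L)) μ ≠ ⊥ := fun h =>
    hμ (by rw [← Subgroup.card_eq_one, ← hc, h, Subgroup.card_bot])
  have hμ1' : 𝔓.ramificationSubgroup (⊤ : Subgroup (L ≃ₐ[K] L)) (μ + 1) = ⊥ :=
    Subgroup.card_eq_one.mp (by rw [hc, hμ1, Subgroup.card_bot])
  have h := card_dvd_ramificationCardSum_of_exists_sub_natCast_notMem 𝔓 h𝔓 ⊤ hH hbig hμ' hμ1'
  rw [ramificationCardSum, Subgroup.card_top] at h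
  simp only [hc] at h
  exact h

omit [IsDedekindDomain R] [IsFractionRing R K] [FiniteDimensional K L] [IsGalois K L] in
/-- Irreducibility of `f = X² - tX + n` over `L` (and `K`) from the absence of roots modulo `𝔓`
(roots in `L` are integral). [folklore] -/
theorem irreducible_map_map_quadPoly_of_forall_notMem (t n : R) (𝔓 : Ideal (integralClosure R L))
    [𝔓.IsPrime]
    (hnoroot : ∀ s : integralClosure R L,
      s * s - algebraMap R (integralClosure R L) t * s + algebraMap R (integralClosure R L) n ∉ 𝔓) :
    Irreducible (((quadPoly t n).map (algebraMap R K)).map (algebraMap K L)) := by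
  haveI : Nontrivial R := (algebraMap R K).domain_nontrivial
  have hm := monic_map_map_quadPoly K L t n
  refine (Polynomial.Monic.irreducible_iff_roots_eq_zero_of_degree_le_three hm.1
    (by rw [hm.2]) (by rw [hm.2]; norm_num)).mpr (Multiset.eq_zero_of_forall_notMem fun r hr => ?_)
  rw [Polynomial.mem_roots hm.1.ne_zero, Polynomial.IsRoot, Polynomial.eval_map, Polynomial.eval₂_map,
    ← IsScalarTower.algebraMap_eq] at hr
  have hr' : Polynomial.eval₂ (algebraMap R L) r (quadPoly t n) = r * r - algebraMap R L t * r + algebraMap R L n := by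
    show Polynomial.eval₂ (algebraMap R L) r (X ^ 2 - C t * X + C n) = _
    rw [Polynomial.eval₂_add, Polynomial.eval₂_sub, Polynomial.eval₂_mul, Polynomial.eval₂_X_pow,
      Polynomial.eval₂_C, Polynomial.eval₂_C, Polynomial.eval₂_X]
    ring
  have hrint : IsIntegral R r := ⟨quadPoly t n, monic_quadPoly t n, hr⟩
  apply hnoroot ⟨r, hrint⟩
  have h0 : (⟨r, hrint⟩ : integralClosure R L) * ⟨r, hrint⟩ -
      algebraMap R (integralClosure R L) t * ⟨r, hrint⟩ + algebraMap R (integralClosure R L) n = 0 :=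
    Subtype.ext (by
      simp only [Subalgebra.coe_add, Subalgebra.coe_sub, Subalgebra.coe_mul, Subalgebra.coe_algebraMap,
        ZeroMemClass.coe_zero]
      rw [← hr', hr])
  rw [h0]
  exact Submodule.zero_mem _

set_option maxHeartbeats 1600000 in
/-- **Prop. V.11, residue field the prime field**: `|G| ∣ Σ_{i=1}^{μ} |G_i|` when every residue
class modulo `𝔓` is the class of a natural number (`κ(𝔓) = 𝔽_p`).  We choose an unramified
quadratic `f` (`X² + X + 1` if `p = 2`, `X² - c` with `c̄` a non-square if `p` is odd) and apply
`card_dvd_sum_card_ramificationSubgroup_of_quadPoly` (the base change `L_f = L[X]/(f)`).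
Ref: Serre, *Local Fields*, Ch. V §4 Lemma 7, §7 p. 94. [cite: SerreLocalFields1979, Ch. V §7 Prop. 11] -/
theorem card_dvd_sum_card_of_forall_exists_sub_natCast_mem [IsCyclic (L ≃ₐ[K] L)]
    (𝔓 : Ideal (integralClosure R L)) [h𝔓max : 𝔓.IsMaximal] (h𝔓 : 𝔓 ≠ ⊥)
    [Algebra.IsSeparable (R ⧸ 𝔓.under R) (integralClosure R L ⧸ 𝔓)]
    (htot : 𝔓.inertia (L ≃ₐ[K] L) = ⊤)
    (hsmall : ∀ b : integralClosure R L, ∃ m : ℕ, b - m ∈ 𝔓) {μ : ℕ}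
    (hμ : 𝔓.ramificationSubgroup (L ≃ₐ[K] L) μ ≠ ⊥)
    (hμ1 : 𝔓.ramificationSubgroup (L ≃ₐ[K] L) (μ + 1) = ⊥) :
    Nat.card (L ≃ₐ[K] L) ∣ ∑ i ∈ Finset.Icc 1 μ, Nat.card (𝔓.ramificationSubgroup (L ≃ₐ[K] L) i) := by
  classical
  haveI : Nontrivial R := (algebraMap R K).domain_nontrivial
  haveI h𝔓prime : 𝔓.IsPrime := Ideal.IsMaximal.isPrime h𝔓max
  letI : Field (integralClosure R L ⧸ 𝔓) := Ideal.Quotient.field 𝔓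
  set π := Ideal.Quotient.mk 𝔓 with hπ
  have hnat : ∀ c : integralClosure R L ⧸ 𝔓, ∃ m : ℕ, c = m := fun c => by
    obtain ⟨b, rfl⟩ := Ideal.Quotient.mk_surjective c
    obtain ⟨m, hm⟩ := hsmall b
    refine ⟨m, ?_⟩
    rw [← sub_eq_zero, ← map_natCast (Ideal.Quotient.mk 𝔓), ← map_sub, Ideal.Quotient.eq_zero_iff_mem]
    exact hm
  -- the residue characteristic `p > 0` and finiteness of the residue field
  obtain ⟨p, hp⟩ := CharP.exists (integralClosure R L ⧸ 𝔓)
  have hp0 : p ≠ 0 := by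
    intro h0
    subst h0
    haveI : CharZero (integralClosure R L ⧸ 𝔓) := CharP.charP_to_charZero _
    obtain ⟨m, hm⟩ := hnat (-1)
    have : ((m + 1 : ℕ) : integralClosure R L ⧸ 𝔓) = 0 := by push_cast; rw [← hm]; ring
    exact Nat.succ_ne_zero m (Nat.cast_eq_zero.mp this)
  have hpprime : p.Prime := (CharP.char_is_prime_or_zero (integralClosure R L ⧸ 𝔓) p).resolve_right hp0
  haveI hfin : Finite (integralClosure R L ⧸ 𝔓) := by
    refine Finite.of_surjective (fun m : Fin p => ((m : ℕ) : integralClosure R L ⧸ 𝔓)) fun c => ?_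
    obtain ⟨m, rfl⟩ := hnat c
    exact ⟨⟨m % p, Nat.mod_lt _ (Nat.pos_of_ne_zero hp0)⟩, (CharP.cast_eq_mod _ p m).symm⟩
  have hπcast : ∀ m : ℕ, π (m : integralClosure R L) = (m : integralClosure R L ⧸ 𝔓) := fun m => map_natCast π m
  have halgR : ∀ r : R, (algebraMap R (integralClosure R L) r : L) = algebraMap R L r := fun r => rfl
  -- `(k : κ) = 0 ↔ p ∣ k`
  have hcast0 : ∀ k : ℕ, ((k : integralClosure R L ⧸ 𝔓) = 0 ↔ p ∣ k) := fun k => CharP.cast_eq_zero_iff _ p k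
  ------------------------------------------------------------------
  -- choice of `t, n` with: no roots mod `𝔓`, `t² - 4n ∉ 𝔓`, `f_K` separable
  ------------------------------------------------------------------
  have hderiv : ∀ (A : Type _) [CommRing A] (a b : A),
      Polynomial.derivative (quadPoly a b) = C 2 * X - C a := fun A _ a b => by
    simp only [quadPoly, Polynomial.derivative_add, Polynomial.derivative_sub, Polynomial.derivative_mul,
      Polynomial.derivative_X_pow, Polynomial.derivative_C, Polynomial.derivative_X, Nat.cast_ofNat]
    ring
  have hπalg : ∀ r : R, π (algebraMap R (integralClosure R L) r) =
      algebraMap R (integralClosure R L ⧸ 𝔓) r := fun r => rfl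
  obtain ⟨t, n, hnoroot, hd, hder⟩ : ∃ t n : R,
      (∀ s : integralClosure R L,
        s * s - algebraMap R (integralClosure R L) t * s + algebraMap R (integralClosure R L) n ∉ 𝔓) ∧
      algebraMap R (integralClosure R L) (t ^ 2 - 4 * n) ∉ 𝔓 ∧
      Polynomial.derivative ((quadPoly t n).map (algebraMap R K)) ≠ 0 := by
    by_cases hp2 : p = 2
    · subst hp2
      refine ⟨-1, 1, fun s hs => ?_, fun h => ?_, fun h => ?_⟩
      · obtain ⟨m, hm⟩ := hnat (π s)
        have h1 := Ideal.Quotient.eq_zero_iff_mem.mpr hs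
        rw [← hπ] at h1
        simp only [map_add, map_sub, map_mul, map_neg, map_one, hm] at h1
        have h2 : ((m * m + m + 1 : ℕ) : integralClosure R L ⧸ 𝔓) = 0 := by
          push_cast; linear_combination h1
        rw [hcast0] at h2
        obtain ⟨k, hk⟩ := Nat.even_mul_succ_self m
        obtain ⟨j, hj⟩ := h2
        have hmm : m * m + m = m * (m + 1) := by ring
        omega
      · have h1 := Ideal.Quotient.eq_zero_iff_mem.mpr h
        rw [← hπ, show ((-1 : R) ^ 2 - 4 * 1) = -(3 : R) by norm_num, map_neg, map_neg, map_ofNat,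
          map_ofNat, neg_eq_zero] at h1
        have h2 : ((3 : ℕ) : integralClosure R L ⧸ 𝔓) = 0 := by exact_mod_cast h1
        rw [hcast0] at h2
        omega
      · rw [Polynomial.derivative_map, hderiv] at h
        have h1 := congrArg (Polynomial.eval 0) h
        simp only [Polynomial.eval_map, Polynomial.eval₂_sub, Polynomial.eval₂_mul, Polynomial.eval₂_C,
          Polynomial.eval₂_X, Polynomial.eval_zero] at h1
        rw [mul_zero, zero_sub, map_neg, map_one, neg_neg] at h1
        exact one_ne_zero h1
    · -- `p` odd: a non-square residue
      have hring : ringChar (integralClosure R L ⧸ 𝔓) ≠ 2 := by rw [ringChar.eq _ p]; exact hp2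
      obtain ⟨c, hc⟩ := FiniteField.exists_nonsquare hring
      obtain ⟨m₀, rfl⟩ := hnat c
      have h2ne : ((2 : ℕ) : integralClosure R L ⧸ 𝔓) ≠ 0 := fun h => by
        rw [hcast0] at h
        exact hp2 ((Nat.prime_dvd_prime_iff_eq hpprime Nat.prime_two).mp h)
      refine ⟨0, -(m₀ : R), fun s hs => hc ?_, fun h => ?_, fun h => ?_⟩
      · have h1 := Ideal.Quotient.eq_zero_iff_mem.mpr hs
        rw [← hπ] at h1
        simp only [map_add, map_mul, map_neg, map_zero, map_natCast, zero_mul, sub_zero] at h1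
        exact ⟨π s, by linear_combination -h1⟩
      · have h1 := Ideal.Quotient.eq_zero_iff_mem.mpr h
        rw [← hπ, show ((0 : R) ^ 2 - 4 * -(m₀ : R)) = 2 * 2 * (m₀ : R) by ring] at h1
        simp only [map_mul, map_natCast, map_ofNat] at h1
        have h3 : ((2 : ℕ) : integralClosure R L ⧸ 𝔓) * ((2 : ℕ) : integralClosure R L ⧸ 𝔓) *
            (m₀ : integralClosure R L ⧸ 𝔓) = 0 := by push_cast; exact h1
        rcases mul_eq_zero.mp h3 with h4 | h4
        · rcases mul_eq_zero.mp h4 with h5 | h5 <;> exact h2ne h5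
        · exact hc (by rw [h4]; exact IsSquare.zero)
      · rw [Polynomial.derivative_map, hderiv] at h
        have h1 := congrArg (Polynomial.eval 1) h
        simp only [Polynomial.eval_map, Polynomial.eval₂_sub, Polynomial.eval₂_mul, Polynomial.eval₂_C,
          Polynomial.eval₂_X, Polynomial.eval_zero] at h1
        rw [mul_one, map_zero, sub_zero] at h1
        -- `(2 : K) = 0` forces `p = 2`
        apply h2ne
        have h2R' : (2 : R) = 0 := (IsFractionRing.injective R K) (by rw [h1, map_zero])
        have : (2 : integralClosure R L) = 0 := by
          rw [show (2 : integralClosure R L) = algebraMap R _ 2 by rw [map_ofNat], h2R', map_zero]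
        have h4 : π 2 = 0 := by rw [this, map_zero]
        rw [map_ofNat] at h4
        exact_mod_cast h4
  ------------------------------------------------------------------
  -- irreducibility, separability, and the base change
  ------------------------------------------------------------------
  have hirrL := irreducible_map_map_quadPoly_of_forall_notMem K L t n 𝔓 hnoroot
  haveI : Fact (Irreducible (((quadPoly t n).map (algebraMap R K)).map (algebraMap K L))) := ⟨hirrL⟩
  have hmK := monic_map_quadPoly K t n
  have hirrK : Irreducible ((quadPoly t n).map (algebraMap R K)) :=
    irreducible_of_irreducible_map K L _ hmK.1 hirrL
  have hsep : ((quadPoly t n).map (algebraMap R K)).Separable :=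
    (Polynomial.separable_iff_derivative_ne_zero hirrK).mpr hder
  exact card_dvd_sum_card_ramificationSubgroup_of_quadPoly K L t n hsep 𝔓 h𝔓 hnoroot hd htot hfin hμ hμ1

set_option maxHeartbeats 800000 in
/-- **Serre V §7, Proposition 11 (completion-free, for Dedekind domains)**: for `L/K` finite
Galois with *cyclic* group `G`, `R` Dedekind with fraction field `K`, and a maximal ideal `𝔓` of
`integralClosure R L` with separable residue extension at which `L/K` is totally ramified
(`T_𝔓 = G`): if `G_μ ≠ 1` and `G_{μ+1} = 1` then `φ_{L/K}(μ) ∈ ℕ`.  This is the hypothesis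
`h11` of `hasseArf_of_cyclic`.  Proof: `|G_0| = |G|` divides `Σ_{i=0}^{μ} |G_i|` by
`card_dvd_sum_card_of_exists_sub_natCast_notMem` (residue field not the prime field) or
`card_dvd_sum_card_of_forall_exists_sub_natCast_mem` (residue field the prime field), and
`φ(μ) + 1 = |G_0|⁻¹ Σ_{i=0}^{μ} |G_i|` (`exists_natCast_eq_herbrandPhi_of_dvd`).
Ref: Serre, *Local Fields*, Ch. V §7, Prop. 11. [cite: SerreLocalFields1979, Ch. V §7 Prop. 11] -/
theorem exists_natCast_eq_herbrandPhi_of_isCyclic_of_inertia_eq_top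
    (𝔓 : Ideal (integralClosure R L)) [𝔓.IsMaximal]
    [Algebra.IsSeparable (R ⧸ 𝔓.under R) (integralClosure R L ⧸ 𝔓)]
    (hcyc : IsCyclic (L ≃ₐ[K] L)) (htot : 𝔓.inertia (L ≃ₐ[K] L) = ⊤) (μ : ℕ)
    (hμ : 𝔓.ramificationSubgroup (L ≃ₐ[K] L) μ ≠ ⊥)
    (hμ1 : 𝔓.ramificationSubgroup (L ≃ₐ[K] L) (μ + 1) = ⊥) :
    ∃ m : ℕ, (m : ℝ) = herbrandPhi 𝔓 (L ≃ₐ[K] L) μ := by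
  classical
  haveI := hcyc
  haveI : FaithfulSMul (L ≃ₐ[K] L) (integralClosure R L) := faithfulSMul_algEquiv_integralClosure R
  -- `𝔓 ≠ 0` (otherwise every `G_i`, `i ≥ 0`, is trivial)
  have h𝔓 : 𝔓 ≠ ⊥ := by
    rintro rfl
    apply hμ
    refine (Subgroup.eq_bot_iff_forall _).mpr fun σ hσ => ?_
    obtain ⟨-, h2⟩ := (Ideal.mem_ramificationSubgroup_iff).mp hσ
    refine FaithfulSMul.eq_of_smul_eq_smul (α := integralClosure R L) fun x => ?_
    have h := h2 x
    rw [← Ideal.zero_eq_bot, zero_pow (Nat.succ_ne_zero μ), Ideal.zero_eq_bot, Submodule.mem_bot,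
      sub_eq_zero] at h
    rw [h, one_smul]
  -- `|G| ∣ Σ_{i=1}^{μ} |G_i|`
  have hdvd : Nat.card (L ≃ₐ[K] L) ∣
      ∑ i ∈ Finset.Icc 1 μ, Nat.card (𝔓.ramificationSubgroup (L ≃ₐ[K] L) i) := by
    by_cases hbig : ∃ b : integralClosure R L, ∀ m : ℕ, b - m ∉ 𝔓
    · exact card_dvd_sum_card_of_exists_sub_natCast_notMem K L 𝔓 h𝔓 htot hbig hμ hμ1
    · push Not at hbig
      exact card_dvd_sum_card_of_forall_exists_sub_natCast_mem K L 𝔓 h𝔓 htot hbig hμ hμ1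
  -- `|G_0| ∣ Σ_{i=0}^{μ} |G_i|`
  refine exists_natCast_eq_herbrandPhi_of_dvd R 𝔓 μ ?_
  have h0 : 𝔓.ramificationSubgroup (L ≃ₐ[K] L) 0 = ⊤ := by rw [Ideal.ramificationSubgroup_zero, htot]
  rw [Finset.range_eq_Ico, Finset.sum_eq_sum_Ico_succ_bot (Nat.succ_pos μ), h0, Subgroup.card_top,
    zero_add, Nat.succ_eq_add_one, Finset.Ico_add_one_right_eq_Icc]
  exact (Nat.dvd_add_right (dvd_refl _)).mpr hdvd

end Prop11

/-! ### The Hasse–Arf theorem and the integrality fact -/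

section Main

variable {R : Type u} {K : Type v} {L : Type w} [CommRing R] [Field K] [Field L] [Algebra R K]
  [Algebra R L] [Algebra K L] [IsScalarTower R K L]

/-- **The Hasse–Arf theorem** (Serre, *Local Fields*, Ch. IV §3 and Ch. V §7, Thm 1'), in the
global form of the named fact `Literature.NumberTheory.GaloisRepresentations.hasseArf`: for `R`
Dedekind with fraction field `K`, `L/K` finite abelian, and a maximal ideal `𝔓` of
`integralClosure R L` with separable residue extension, every jump `v` of the upper numbering
filtration `(G^v)` at `𝔓` is an integer.  Proof: `hasseArf_of_cyclic` (reduction to the cyclic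
totally ramified case, Serre V §7 "Prop. 11 ⇒ Thm 1") applied to
`exists_natCast_eq_herbrandPhi_of_isCyclic_of_inertia_eq_top` (Prop. 11, proved completion-free in
`HasseArfCyclic` with the residue field enlargement of `HasseArfResidueExt`).
Ref: Serre, *Local Fields*, Ch. IV §3, Theorem (Hasse–Arf); Ch. V §7, Thm 1, Thm 1', Prop. 11.
[cite: SerreLocalFields1979, Ch. IV §3, Theorem (Hasse–Arf)] -/
theorem hasseArf_holds : hasseArf R (K := K) (L := L) :=
  hasseArf_of_cyclic fun _ K' L' _ _ _ _ _ _ _ _ _ _ _ 𝔓' _ _ hcyc htot μ hμ hμ1 =>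
    exists_natCast_eq_herbrandPhi_of_isCyclic_of_inertia_eq_top K' L' 𝔓' hcyc htot μ hμ hμ1

variable (R) in
/-- **Discharge of `card_inf_inertia_dvd_finsum_card_inf_ramificationSubgroup`** (Serre,
*Local Fields*, Ch. VI §2, proof of Thm 1', from Hasse–Arf): for every subgroup `H` of
`Gal(L/K)` and every character `θ : H → ℂˣ` of degree `1`,
`|H ∩ G_0| ∣ Σ_{i : (H ∩ G_i) ⊄ ker θ} |H ∩ G_i|`.  By
`card_inf_inertia_dvd_finsum_card_inf_ramificationSubgroup_of_hasseArf` (the reduction to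
Hasse–Arf, already in the tree) and `hasseArf_holds`.
Ref: Serre, *Local Fields*, Ch. VI §2, Thm 1' and its proof; Ch. IV §3 (Hasse–Arf).
[cite: SerreLocalFields1979, Ch. VI §2 Thm 1'] -/
theorem card_inf_inertia_dvd_finsum_card_inf_ramificationSubgroup_holds :
    card_inf_inertia_dvd_finsum_card_inf_ramificationSubgroup R (K := K) (L := L) :=
  card_inf_inertia_dvd_finsum_card_inf_ramificationSubgroup_of_hasseArf fun _ _ _ _ _ _ _ _ _ _ =>
    hasseArf_holds

end Main


end Literature.NumberTheory.GaloisRepresentations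

end
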